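import Mathlib
import Summits.Ventures.HodgeRepro2.A1SplitExteriorSummand
import Summits.Ventures.HodgeRepro2.A1SplitExteriorStable
import Summits.Ventures.HodgeRepro2.A1SplitSummandDescent

/-!
# The external and the internal model of the split summand agree

Blind cell `pub-hodge-repro2`, seat p7 (gen 10), A1 annex (route/T4-A1-p7.md, Lemma A1.3;
route/LEAN-ANNEX-p7.md rows 35 / 39 / 43).  Gen 9 treated Deligne's split summand
`⊕_s ⋀^n V_s ⊂ ⋀^n (⊕_s V_s)` in the EXTERNAL model (`A1SplitExteriorSummand.incl` on a
`DirectSum`); gen 10 works INTERNALLY (`A1SplitSummandDescent.splitSummand U = ⨆ i, ⋀^n (U i)`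
inside `⋀^n W` for submodules `U i ⊆ W`).  This file records that the two agree: for an internal
direct sum `W = ⊕_i U i` (`DirectSum.IsInternal U`), the linear equivalence
`⊕_i U i ≃ W` carries the external summand `range incl` onto `splitSummand U`
(`map_range_incl_eq_splitSummand`), so the external statements (injectivity of `incl`, the
complement `ker proj`) transfer to the internal summand (`isCompl_splitSummand`).

README §8(d): uses an L-value-free non-vanishing device: NO.
-/

namespace Summit.Ventures.HodgeRepro2.A1SplitSummandModels

open Summit.Ventures.HodgeRepro2.A1SplitExteriorSummand
open Summit.Ventures.HodgeRepro2.A1SplitExteriorStable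
open Summit.Ventures.HodgeRepro2.A1SplitSummandDescent

variable {R W : Type*} [CommRing R] [AddCommGroup W] [Module R W] (n : ℕ)
variable {ι : Type*} [DecidableEq ι] (U : ι → Submodule R W)

/-- The external direct sum `⊕_i U i` mapped to `W` (`DirectSum.coeLinearMap`), composed with the
`i`-th inclusion, is the inclusion of `U i`. -/
theorem coeLinearMap_comp_lof (i : ι) :
    DirectSum.coeLinearMap U ∘ₗ DirectSum.lof R ι (fun i => U i) i = (U i).subtype := by
  ext x
  simp [DirectSum.lof_eq_of, DirectSum.coeLinearMap_of]

/-- **The external summand maps onto the internal one**: under `⋀^n (⊕_i U i → W)`, the range of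
`incl` is carried onto `splitSummand n U` (no hypothesis on `U`). -/
theorem map_range_incl_eq_splitSummand :
    (LinearMap.range (incl R (fun i => U i) n)).map (exteriorPower.map n (DirectSum.coeLinearMap U)) =
      splitSummand n U := by
  rw [range_incl_eq_iSup, Submodule.map_iSup]
  unfold splitSummand
  congr 1
  ext i : 1
  rw [← LinearMap.range_comp, ← exteriorPower.map_comp, coeLinearMap_comp_lof]

section Internal

variable (h : DirectSum.IsInternal U)

/-- The linear equivalence `⊕_i U i ≃ W` of an internal direct sum. -/
noncomputable def internalEquiv : (DirectSum ι fun i => U i) ≃ₗ[R] W :=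
  LinearEquiv.ofBijective (DirectSum.coeLinearMap U) h

/-- `⋀^n` of the linear equivalence `⊕_i U i ≃ W`. -/
noncomputable def exteriorInternalEquiv :
    ⋀[R]^n (DirectSum ι fun i => U i) ≃ₗ[R] ⋀[R]^n W :=
  LinearEquiv.ofLinear (exteriorPower.map n (internalEquiv U h).toLinearMap)
    (exteriorPower.map n (internalEquiv U h).symm.toLinearMap)
    (by rw [← exteriorPower.map_comp, LinearEquiv.comp_symm, exteriorPower.map_id])
    (by rw [← exteriorPower.map_comp, LinearEquiv.symm_comp, exteriorPower.map_id])

/-- `exteriorInternalEquiv` is `⋀^n (coeLinearMap)` as a function. -/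
theorem exteriorInternalEquiv_apply (x : ⋀[R]^n (DirectSum ι fun i => U i)) :
    exteriorInternalEquiv n U h x = exteriorPower.map n (DirectSum.coeLinearMap U) x := rfl

/-- **The two models agree** for an internal direct sum: `⋀^n (⊕ U i ≃ W)` carries
`range incl` onto `splitSummand n U`. -/
theorem map_range_incl_equiv_eq_splitSummand :
    (LinearMap.range (incl R (fun i => U i) n)).map
      (exteriorInternalEquiv n U h : ⋀[R]^n (DirectSum ι fun i => U i) →ₗ[R] ⋀[R]^n W) =
      splitSummand n U :=
  map_range_incl_eq_splitSummand n U

/-- **The internal split summand is a direct summand** (transport of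
`A1SplitExteriorSummand.isCompl_range_incl`): for `n ≠ 0` and a finite internal direct sum
`W = ⊕_i U i`, `splitSummand n U` has the complement `(ker proj)` carried over by the equivalence. -/
theorem isCompl_splitSummand [Fintype ι] (hn : n ≠ 0) :
    IsCompl (splitSummand n U)
      ((LinearMap.ker (proj R (fun i => U i) n)).map
        (exteriorInternalEquiv n U h : ⋀[R]^n (DirectSum ι fun i => U i) →ₗ[R] ⋀[R]^n W)) := by
  rw [← map_range_incl_equiv_eq_splitSummand n U h]
  have := (Submodule.orderIsoMapComap (exteriorInternalEquiv n U h)).isCompl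
    (isCompl_range_incl R (fun i => U i) n hn)
  simpa only [Submodule.orderIsoMapComap_apply] using this

end Internal

end Summit.Ventures.HodgeRepro2.A1SplitSummandModels
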